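import Summits.QuantumFields.BalabanUV.Beta.GAN24.SymContactBorderPairEntryBound
import Summits.QuantumFields.BalabanUV.Beta.GAN24.CombBornBorderContactPairCount
import Summits.QuantumFields.BalabanUV.Beta.GAN24.BornBorderContactPairLineage

/-!
# `BalabanUV.Beta.GAN24.CombBornBorderContactPairLineage` — row G-an2-4 ∕ (CONV-C), TRANSFER-III, the (III′) S-slot (b), born-V contact PAIR `hPcV` of road-P2 M.104: **THE
# WEIGHTED CONTACT PAIR OF ONE (III′) V LINEAGE** (`d = 3`) — leaf-03 g56's (E) `BornBorderContactPairLineage.abs_weight_mul_contact_v_pair_le_three` with ABSTRACT legs `T, T′`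
# (envelopes), their pure-gauge families (`hTB, hTBp`), the three `(n+1)`-staircases `(hψ,hG), (hψq,hGq), (hψΔ,hGΔ)` as HYPOTHESES with gauge letters `A·C₁·u`, `A·c_Δ·u`
# (the OWNER's `CombContactGaugeStaircaseMergedPair` supplies them for the conjugated chains), the table an1's symmetrised border `cVH • symVhSAt ρ_t` through the OWNER's
# (16) `SymContactBorderPairEntryBound`, the count `CombBornBorderContactPairCount.weighted_comb_pair_le_of_cells` (OWNER `b2b-balaban-gan24-p1` gen 55; `HCV-DESIGN-g55.md` §2)

NOT IN PRINT — OUR PROOF ATTEMPT ([folklore] bookkeeping; the (E) proof token for token minus its gauge plumbing; every analytic input a HYPOTHESIS with explicit constants —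
`CombBornBorderContactPairBound` discharges them).  0 `def`, 0 cited fact, 0 `def … : Prop`, 0 sorry; NO estimate of Bałaban's.
HONEST FRAMING (cell contract, verbatim): «discharging `BetaPertH` makes Bałaban's UV stability UNCONDITIONAL — a real constructive-QFT result; it is NOT the continuum limit
and NOT the Clay problem.»  HONEST DEPENDENCY (verbatim): «continuum YM on T⁴ ⇐ BetaPertH ∧ nine spine estimates (0/9 proved); BetaPertH ⇐ (D1) ∧ (D4) ∧ CAP+tail; G-an2-4
gates asym, D1 and NE2/3/4.»  Discharges nothing; NEVER «G-an2-4 closed» as (CONV-C); NOT D1, NOT BetaPertH, NOT continuum, NOT Clay.  2026-08-28; no existing file touched.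
-/

noncomputable section

open scoped BigOperators
open Literature.MathematicalPhysics.QuantumFieldTheory
open Literature.MathematicalPhysics.QuantumFieldTheory.LatticeForm (quo)
open Literature.MathematicalPhysics.QuantumFieldTheory.Balaban1983to89
open Literature.MathematicalPhysics.QuantumFieldTheory.Balaban1983to89.Beta
open B4ContourShift (supNorm supNorm_nonneg)
open B12Sec2to5 (l1 l1_nonneg)
open ExpKernelCalculus (MKer Zl Zl_nonneg)
open AffineAveraging (Form0 Form1 Site box toSite unitVec dz)
open AveragingContours (blk)
open AveragingHessianKernels (ell)
open Summit.QuantumFields.BalabanUV.Beta.SymAveragingHessianCounts (symVhSAt)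
open OneStepResolventKernel (Fib)
open KKTFluctuationKernel (delta1)
open BalabanCompositeJets (respStep)
open Summit.QuantumFields.BalabanUV.Beta.AxialProjectorBlockMean (bmGaugeAt)
open Summit.QuantumFields.BalabanUV.Beta.GAN24.RespStepBmDecompLegs (legAct)
open Summit.QuantumFields.BalabanUV.Beta.GAN24.RespStepBmDecompPsi (Psi)
open Summit.QuantumFields.BalabanUV.Beta.GAN24.RespStepBmDecompExact (respStepBmSeq)
open Summit.QuantumFields.BalabanUV.Beta.GAN24.Push4Iter (legChain)
open Summit.QuantumFields.BalabanUV.Beta.GAN24.Push3 (push₃ isFF_push₃)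
open Summit.QuantumFields.BalabanUV.Beta.GAN24.Push3LegTelescope (push₃_neg_left abs_le_of_env' summable_of_env')
open Summit.QuantumFields.BalabanUV.Beta.GAN24.SrecLinearPartEq (reslot)
open Summit.QuantumFields.BalabanUV.Beta.GAN24.ContactLambdaCellBound (exp_env_mono_rate)
open Summit.QuantumFields.BalabanUV.Beta.GAN24.ContactBorderCommutator (push₃_reslot_smul)
open Summit.QuantumFields.BalabanUV.Beta.GAN24.SymContactBorderPairEntryBound (abs_contact_border_fm_pair_le abs_contact_border_mf_pair_le)
open Summit.QuantumFields.BalabanUV.Beta.GAN24.CombBornBorderContactPairCount (weighted_comb_pair_le_of_cells)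

namespace Summit.QuantumFields.BalabanUV.Beta.GAN24.CombBornBorderContactPairLineage

section Lineage

variable {Lc : ℕ} [NeZero Lc]
variable {rt : Fin (3 + 1) → ℕ} {i n : ℕ} {cE cVH : ℝ} {C₁ κ₁ κ₂ cΔ KE κE CM' CM'p Tb TΔ δK A : ℝ}
  {T Tp : Fin (3 + 1) → (Fin (3 + 1) → ℤ) → Fin (3 + 1) → (Fin (3 + 1) → ℤ) → ℝ}
  {lam lamq : Fin (3 + 1) → Site (3 + 1) → Site (3 + 1) → ℝ} {Gp Gq GΔ : Fin (3 + 1) → Site (3 + 1) → ℕ → Site (3 + 1) → ℝ}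
  {M Mp M' M'p : Fin (3 + 1) → (Fin (3 + 1) → ℤ) → Fin (3 + 1) → (Fin (3 + 1) → ℤ) → ℝ}

set_option maxHeartbeats 800000 in
/-- NOT IN PRINT; OUR PROOF ATTEMPT ([folklore]; `d = 3`, `2 ≤ Lc`; see the module docstring).  **THE WEIGHTED CONTACT PAIR OF ONE (III′) V LINEAGE**, every letter a HYPOTHESIS. -/
theorem abs_weight_mul_comb_contact_v_pair_le_three (hLc : 2 ≤ Lc) (hrt : rt ∈ box (3 + 1) Lc) (hcE : |cE| ≤ (Lc : ℝ) ^ 4)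
    (hN1 : ∀ (m k : ℕ) (μ : Fin (3 + 1)) (z : Site (3 + 1)) (l'' : Fin (3 + 1)) (w' : Site (3 + 1)),
      |respStep (d := 3) (Lc ^ m) (Lc ^ (m + k + 1)) μ z l'' w'| ≤
        C₁ * ((Lc : ℝ) ^ (5 * (k + 1)))⁻¹ * Real.exp (-(κ₁ * supNorm (quo (Lc ^ (k + 1)) w' - z))))
    (hκ₁ : 0 < κ₁) (hC₁ : 0 ≤ C₁) (hκ₂ : 0 < κ₂) (hcΔ : 0 ≤ cΔ)
    (hBΔ : ∀ (μ : Fin (3 + 1)) (z : Site (3 + 1)) (l : Fin (3 + 1)) (u : Site (3 + 1)),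
      |respStep (d := 3) (Lc ^ (i + 1)) (Lc ^ (i + 1 + n + 1)) μ z l u - respStep (d := 3) (Lc ^ i) (Lc ^ (i + n + 1)) μ z l u|
        ≤ cΔ * ((Lc : ℝ) ^ (5 * (n + 1)))⁻¹ * Real.exp (-(κ₂ * supNorm (quo (Lc ^ (n + 1)) u - z))))
    (hA : 0 ≤ A)
    (hTB : T - respStep (d := 3) (Lc ^ i) (Lc ^ (i + n + 1)) = fun μ z l u => dz (lam μ z) l u)
    (hTBp : Tp - respStep (d := 3) (Lc ^ (i + 1)) (Lc ^ (i + 1 + n + 1)) = fun μ z l u => dz (lamq μ z) l u)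
    (hψ : ∀ (μ₀ : Fin (3 + 1)) (z₀ u : Site (3 + 1)), lam μ₀ z₀ u = ∑ s ∈ Finset.range (n + 1), Gp μ₀ z₀ s (blk (Lc ^ s) u))
    (hψq : ∀ (μ₀ : Fin (3 + 1)) (z₀ u : Site (3 + 1)), lamq μ₀ z₀ u = ∑ s ∈ Finset.range (n + 1), Gq μ₀ z₀ s (blk (Lc ^ s) u))
    (hψΔ : ∀ (μ₀ : Fin (3 + 1)) (z₀ u : Site (3 + 1)), lamq μ₀ z₀ u - lam μ₀ z₀ u = ∑ s ∈ Finset.range (n + 1), GΔ μ₀ z₀ s (blk (Lc ^ s) u))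
    (hGA : ∀ (μ₀ : Fin (3 + 1)) (z₀ : Site (3 + 1)) (s : ℕ), s ≤ n → ∀ u : Site (3 + 1),
      |Gp μ₀ z₀ s (blk (Lc ^ s) u)| ≤ A * C₁ * ((Lc : ℝ) ^ (5 * (n + 1)))⁻¹ * (Lc : ℝ) ^ s * Real.exp (-(κ₁ * supNorm (quo (Lc ^ (n + 1)) u - z₀))))
    (hGqA : ∀ (μ₀ : Fin (3 + 1)) (z₀ : Site (3 + 1)) (s : ℕ), s ≤ n → ∀ u : Site (3 + 1),
      |Gq μ₀ z₀ s (blk (Lc ^ s) u)| ≤ A * C₁ * ((Lc : ℝ) ^ (5 * (n + 1)))⁻¹ * (Lc : ℝ) ^ s * Real.exp (-(κ₁ * supNorm (quo (Lc ^ (n + 1)) u - z₀))))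
    (hGΔ : ∀ (μ₀ : Fin (3 + 1)) (z₀ : Site (3 + 1)) (s : ℕ), s ≤ n → ∀ u : Site (3 + 1),
      |GΔ μ₀ z₀ s (blk (Lc ^ s) u)| ≤ A * cΔ * ((Lc : ℝ) ^ (5 * (n + 1)))⁻¹ * (Lc : ℝ) ^ s * Real.exp (-(κ₂ * supNorm (quo (Lc ^ (n + 1)) u - z₀))))
    (hE : ∀ μ z l u, |T μ z l u| ≤ KE * Real.exp (-(κE * supNorm (quo (Lc ^ (n + 1)) u - z))))
    (hEp : ∀ μ z l u, |Tp μ z l u| ≤ KE * Real.exp (-(κE * supNorm (quo (Lc ^ (n + 1)) u - z))))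
    (hκE : 0 < κE)
    (hMs : ∀ a b μ, Summable fun z => M a b μ z) (hMps : ∀ a b μ, Summable fun z => Mp a b μ z)
    (hMt : ∀ (a : Fin (3 + 1)) (b : Site (3 + 1)) (μ : Fin (3 + 1)) (y : Site (3 + 1)),
      |M a b μ ((Lc : ℤ) • y)| ≤ Tb * ((((Lc : ℝ) ^ n) ^ (2 * 3 + 1))⁻¹) * Real.exp (-(δK * supNorm (quo (Lc ^ n) y - b))))
    (hMpt : ∀ (a : Fin (3 + 1)) (b : Site (3 + 1)) (μ : Fin (3 + 1)) (y : Site (3 + 1)),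
      |Mp a b μ ((Lc : ℤ) • y)| ≤ Tb * ((((Lc : ℝ) ^ n) ^ (2 * 3 + 1))⁻¹) * Real.exp (-(δK * supNorm (quo (Lc ^ n) y - b))))
    (hMΔt : ∀ (a : Fin (3 + 1)) (b : Site (3 + 1)) (μ : Fin (3 + 1)) (y : Site (3 + 1)),
      |Mp a b μ ((Lc : ℤ) • y) - M a b μ ((Lc : ℤ) • y)| ≤ TΔ * ((((Lc : ℝ) ^ n) ^ (2 * 3 + 1))⁻¹) * Real.exp (-(δK * supNorm (quo (Lc ^ n) y - b))))
    (hM'b : ∀ a b μ z, |M' a b μ z| ≤ CM') (hM's : ∀ a b μ, Summable fun z => M' a b μ z)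
    (hM'pb : ∀ a b μ z, |M'p a b μ z| ≤ CM'p) (hM'ps : ∀ a b μ, Summable fun z => M'p a b μ z)
    (hM't : ∀ (a : Fin (3 + 1)) (b : Site (3 + 1)) (μ : Fin (3 + 1)) (y : Site (3 + 1)),
      |M' a b μ ((Lc : ℤ) • y)| ≤ Tb * ((((Lc : ℝ) ^ n) ^ (2 * 3 + 1))⁻¹) * Real.exp (-(δK * supNorm (quo (Lc ^ n) y - b))))
    (hM'Δt : ∀ (a : Fin (3 + 1)) (b : Site (3 + 1)) (μ : Fin (3 + 1)) (y : Site (3 + 1)),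
      |M'p a b μ ((Lc : ℤ) • y) - M' a b μ ((Lc : ℤ) • y)| ≤ TΔ * ((((Lc : ℝ) ^ n) ^ (2 * 3 + 1))⁻¹) * Real.exp (-(δK * supNorm (quo (Lc ^ n) y - b))))
    (hδK : 0 < δK) (hTb : 0 ≤ Tb) (hTΔ : 0 ≤ TΔ)
    (κ' : Fin (3 + 1)) (u' x z : Site (3 + 1)) (a b : Fib 3) :
    |(cE * (Lc : ℝ) ^ (2 * (3 + 1))) ^ (n + 1) *
        (((push₃ (-Tp) Mp Tp
                (reslot Sum.inl Sum.inr fun κ u => cVH • symVhSAt (toSite rt) 3 Lc rfl κ u) κ' u' x z a b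
              - push₃ (-respStep (d := 3) (Lc ^ (i + 1)) (Lc ^ (i + 1 + n + 1))) Mp (respStep (d := 3) (Lc ^ (i + 1)) (Lc ^ (i + 1 + n + 1)))
                (reslot Sum.inl Sum.inr fun κ u => cVH • symVhSAt (toSite rt) 3 Lc rfl κ u) κ' u' x z a b)
            + (push₃ M'p Tp Tp
                (reslot Sum.inr Sum.inl fun κ u => cVH • symVhSAt (toSite rt) 3 Lc rfl κ u) κ' u' x z a b
              - push₃ M'p (respStep (d := 3) (Lc ^ (i + 1)) (Lc ^ (i + 1 + n + 1))) (respStep (d := 3) (Lc ^ (i + 1)) (Lc ^ (i + 1 + n + 1)))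
                (reslot Sum.inr Sum.inl fun κ u => cVH • symVhSAt (toSite rt) 3 Lc rfl κ u) κ' u' x z a b))
          - ((push₃ (-T) M T
                (reslot Sum.inl Sum.inr fun κ u => cVH • symVhSAt (toSite rt) 3 Lc rfl κ u) κ' u' x z a b
              - push₃ (-respStep (d := 3) (Lc ^ i) (Lc ^ (i + n + 1))) M (respStep (d := 3) (Lc ^ i) (Lc ^ (i + n + 1)))
                (reslot Sum.inl Sum.inr fun κ u => cVH • symVhSAt (toSite rt) 3 Lc rfl κ u) κ' u' x z a b)
            + (push₃ M' T T
                (reslot Sum.inr Sum.inl fun κ u => cVH • symVhSAt (toSite rt) 3 Lc rfl κ u) κ' u' x z a b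
              - push₃ M' (respStep (d := 3) (Lc ^ i) (Lc ^ (i + n + 1))) (respStep (d := 3) (Lc ^ i) (Lc ^ (i + n + 1)))
                (reslot Sum.inr Sum.inl fun κ u => cVH • symVhSAt (toSite rt) 3 Lc rfl κ u) κ' u' x z a b)))|
      ≤ |cVH| * (2 * ((Lc : ℝ) ^ 3 * (((((3 + 1).factorial : ℕ) : ℝ) * (Lc : ℝ) ^ (3 + 1))⁻¹ * (((3 : ℝ) + 1) * (Real.exp (2 * ((3 : ℝ) + 1) * min (min δK κ₁) κ₂) ^ 2 *
              (((2 * Lc : ℕ) : ℝ) ^ (3 + 1) * (((3 + 1 : ℕ) : ℝ) * ((((3 + 1).factorial : ℕ) : ℝ) * ((Lc : ℝ) ^ (3 + 1) * (ell (3 + 1) Lc : ℝ)))))))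
            * ((2 * Tb * C₁ * cΔ + TΔ * C₁ ^ 2) * (4 * A + 4 * A ^ 2 + 4 * A * Lc + 8 * A ^ 2 * Lc))
            * Zl (3 + 1) (min (min δK κ₁) κ₂ / (4 * ((3 : ℝ) + 1))))))
          * ((((n : ℝ) + 1)) * ((Lc : ℝ)⁻¹) ^ (n + 1))
          * Real.exp (-(min (min δK κ₁) κ₂ / 12 / 2 / ((3 : ℝ) + 1)) * (l1 (x - u') + l1 (z - u'))) := by
  have hLc1 : 1 ≤ Lc := le_trans (by norm_num) hLc
  have hL : (0 : ℝ) < (Lc : ℝ) := Nat.cast_pos.2 (Nat.pos_of_ne_zero (NeZero.ne Lc))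
  have hLn1 : 1 ≤ Lc ^ (n + 1) := Nat.one_le_pow _ _ hLc1
  set κ : ℝ := min (min δK κ₁) κ₂ with hκdef
  have hκ : 0 < κ := lt_min (lt_min hδK hκ₁) hκ₂
  have hκK : κ ≤ δK := (min_le_left _ _).trans (min_le_left _ _)
  have hκ1 : κ ≤ κ₁ := (min_le_left _ _).trans (min_le_right _ _)
  have hκ2 : κ ≤ κ₂ := min_le_right _ _
  -- the field-slot letters of both towers at the common rate `κ`
  set B := respStep (d := 3) (Lc ^ i) (Lc ^ (i + n + 1)) with hBdef
  set Bp := respStep (d := 3) (Lc ^ (i + 1)) (Lc ^ (i + 1 + n + 1)) with hBpdef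
  have hT : ∀ μ z' l u, |T μ z' l u| ≤ KE := abs_le_of_env' hκE.le hE
  have hTs : ∀ μ z' l, Summable fun u => T μ z' l u := summable_of_env' hLn1 hκE hE
  have hTp : ∀ μ z' l u, |Tp μ z' l u| ≤ KE := abs_le_of_env' hκE.le hEp
  have hTps : ∀ μ z' l, Summable fun u => Tp μ z' l u := summable_of_env' hLn1 hκE hEp
  have hB : ∀ μ z' l u, |B μ z' l u| ≤ C₁ * ((Lc : ℝ) ^ (5 * (n + 1)))⁻¹ * Real.exp (-(κ * supNorm (quo (Lc ^ (n + 1)) u - z'))) := by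
    intro μ z' l u
    exact (hN1 i n μ z' l u).trans (mul_le_mul_of_nonneg_left (exp_env_mono_rate hκ1 (supNorm_nonneg _)) (by positivity))
  have hBp : ∀ μ z' l u, |Bp μ z' l u| ≤ C₁ * ((Lc : ℝ) ^ (5 * (n + 1)))⁻¹ * Real.exp (-(κ * supNorm (quo (Lc ^ (n + 1)) u - z'))) := by
    intro μ z' l u
    have h := hN1 (i + 1) n μ z' l u
    exact h.trans (mul_le_mul_of_nonneg_left (exp_env_mono_rate hκ1 (supNorm_nonneg _)) (by positivity))
  have hBΔ' : ∀ μ z' l u, |Bp μ z' l u - B μ z' l u| ≤ cΔ * ((Lc : ℝ) ^ (5 * (n + 1)))⁻¹ * Real.exp (-(κ * supNorm (quo (Lc ^ (n + 1)) u - z'))) := by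
    intro μ z' l u
    exact (hBΔ μ z' l u).trans (mul_le_mul_of_nonneg_left (exp_env_mono_rate hκ2 (supNorm_nonneg _)) (by positivity))
  -- the gauge staircase letters at the common rate `κ`
  have hG : ∀ (μ₀ : Fin (3 + 1)) (z₀ : Site (3 + 1)) (s : ℕ), s ≤ n → ∀ u : Site (3 + 1),
      |Gp μ₀ z₀ s (blk (Lc ^ s) u)| ≤ (A * C₁ * ((Lc : ℝ) ^ (5 * (n + 1)))⁻¹) * (Lc : ℝ) ^ s * Real.exp (-(κ * supNorm (quo (Lc ^ (n + 1)) u - z₀))) :=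
    fun μ₀ z₀ s hs u => (hGA μ₀ z₀ s hs u).trans (mul_le_mul_of_nonneg_left (exp_env_mono_rate hκ1 (supNorm_nonneg _)) (by positivity))
  have hGq : ∀ (μ₀ : Fin (3 + 1)) (z₀ : Site (3 + 1)) (s : ℕ), s ≤ n → ∀ u : Site (3 + 1),
      |Gq μ₀ z₀ s (blk (Lc ^ s) u)| ≤ (A * C₁ * ((Lc : ℝ) ^ (5 * (n + 1)))⁻¹) * (Lc : ℝ) ^ s * Real.exp (-(κ * supNorm (quo (Lc ^ (n + 1)) u - z₀))) :=
    fun μ₀ z₀ s hs u => (hGqA μ₀ z₀ s hs u).trans (mul_le_mul_of_nonneg_left (exp_env_mono_rate hκ1 (supNorm_nonneg _)) (by positivity))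
  have hGΔ' : ∀ (μ₀ : Fin (3 + 1)) (z₀ : Site (3 + 1)) (s : ℕ), s ≤ n → ∀ u : Site (3 + 1),
      |GΔ μ₀ z₀ s (blk (Lc ^ s) u)| ≤ (A * cΔ * ((Lc : ℝ) ^ (5 * (n + 1)))⁻¹) * (Lc : ℝ) ^ s * Real.exp (-(κ * supNorm (quo (Lc ^ (n + 1)) u - z₀))) :=
    fun μ₀ z₀ s hs u => (hGΔ μ₀ z₀ s hs u).trans (mul_le_mul_of_nonneg_left (exp_env_mono_rate hκ2 (supNorm_nonneg _)) (by positivity))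
  -- the tents and tent differences at the common rate
  have tent_mono : ∀ {Q : ℝ} {bb : Site (3 + 1)} {y : Site (3 + 1)} {v : ℝ}, 0 ≤ Q →
      v ≤ Q * ((((Lc : ℝ) ^ n) ^ (2 * 3 + 1))⁻¹) * Real.exp (-(δK * supNorm (quo (Lc ^ n) y - bb))) →
      v ≤ (Q * ((((Lc : ℝ) ^ n) ^ (2 * 3 + 1))⁻¹)) * Real.exp (-(κ * supNorm (quo (Lc ^ n) y - bb))) := fun hQ hv =>
    hv.trans (mul_le_mul_of_nonneg_left (exp_env_mono_rate hκK (supNorm_nonneg _)) (by positivity))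
  have hMt' := fun (a : Fin (3 + 1)) (bb : Site (3 + 1)) (μ : Fin (3 + 1)) (y : Site (3 + 1)) => tent_mono hTb (hMt a bb μ y)
  have hMpt' := fun (a : Fin (3 + 1)) (bb : Site (3 + 1)) (μ : Fin (3 + 1)) (y : Site (3 + 1)) => tent_mono hTb (hMpt a bb μ y)
  have hMΔt' := fun (a : Fin (3 + 1)) (bb : Site (3 + 1)) (μ : Fin (3 + 1)) (y : Site (3 + 1)) => tent_mono hTΔ (hMΔt a bb μ y)
  have hM't' := fun (a : Fin (3 + 1)) (bb : Site (3 + 1)) (μ : Fin (3 + 1)) (y : Site (3 + 1)) => tent_mono hTb (hM't a bb μ y)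
  have hM'Δt' := fun (a : Fin (3 + 1)) (bb : Site (3 + 1)) (μ : Fin (3 + 1)) (y : Site (3 + 1)) => tent_mono hTΔ (hM'Δt a bb μ y)
  -- the scale `cVH` and the sign of the fm pushes out; entries
  simp only [push₃_reslot_smul, push₃_neg_left]
  simp only [Pi.smul_apply, Pi.neg_apply, smul_eq_mul]
  set P₁ := push₃ T M T (reslot Sum.inl Sum.inr (symVhSAt (toSite rt) 3 Lc rfl)) κ' u' with hP₁
  set P₂ := push₃ B M B (reslot Sum.inl Sum.inr (symVhSAt (toSite rt) 3 Lc rfl)) κ' u' with hP₂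
  set P₃ := push₃ M' T T (reslot Sum.inr Sum.inl (symVhSAt (toSite rt) 3 Lc rfl)) κ' u' with hP₃
  set P₄ := push₃ M' B B (reslot Sum.inr Sum.inl (symVhSAt (toSite rt) 3 Lc rfl)) κ' u' with hP₄
  set Q₁ := push₃ Tp Mp Tp (reslot Sum.inl Sum.inr (symVhSAt (toSite rt) 3 Lc rfl)) κ' u' with hQ₁
  set Q₂ := push₃ Bp Mp Bp (reslot Sum.inl Sum.inr (symVhSAt (toSite rt) 3 Lc rfl)) κ' u' with hQ₂
  set Q₃ := push₃ M'p Tp Tp (reslot Sum.inr Sum.inl (symVhSAt (toSite rt) 3 Lc rfl)) κ' u' with hQ₃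
  set Q₄ := push₃ M'p Bp Bp (reslot Sum.inr Sum.inl (symVhSAt (toSite rt) 3 Lc rfl)) κ' u' with hQ₄
  have e : (cE * (Lc : ℝ) ^ (2 * (3 + 1))) ^ (n + 1) *
        ((cVH * -Q₁ x z a b - cVH * -Q₂ x z a b + (cVH * Q₃ x z a b - cVH * Q₄ x z a b))
          - (cVH * -P₁ x z a b - cVH * -P₂ x z a b + (cVH * P₃ x z a b - cVH * P₄ x z a b)))
      = ((cE * (Lc : ℝ) ^ (2 * (3 + 1))) ^ (n + 1) * cVH) *
          (((Q₃ x z a b - Q₄ x z a b) - (P₃ x z a b - P₄ x z a b)) - ((Q₁ x z a b - Q₂ x z a b) - (P₁ x z a b - P₂ x z a b))) := by ring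
  rw [e, abs_mul, abs_mul, abs_pow]
  -- the tables are ff-valued
  have hS1 : Push4.IsFF P₁ := isFF_push₃ (l := T) (r := M) (w := T) (reslot Sum.inl Sum.inr (symVhSAt (toSite rt) 3 Lc rfl)) κ' u'
  have hS2 : Push4.IsFF P₂ := isFF_push₃ (l := B) (r := M) (w := B) (reslot Sum.inl Sum.inr (symVhSAt (toSite rt) 3 Lc rfl)) κ' u'
  have hS3 : Push4.IsFF P₃ := isFF_push₃ (l := M') (r := T) (w := T) (reslot Sum.inr Sum.inl (symVhSAt (toSite rt) 3 Lc rfl)) κ' u'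
  have hS4 : Push4.IsFF P₄ := isFF_push₃ (l := M') (r := B) (w := B) (reslot Sum.inr Sum.inl (symVhSAt (toSite rt) 3 Lc rfl)) κ' u'
  have hR1 : Push4.IsFF Q₁ := isFF_push₃ (l := Tp) (r := Mp) (w := Tp) (reslot Sum.inl Sum.inr (symVhSAt (toSite rt) 3 Lc rfl)) κ' u'
  have hR2 : Push4.IsFF Q₂ := isFF_push₃ (l := Bp) (r := Mp) (w := Bp) (reslot Sum.inl Sum.inr (symVhSAt (toSite rt) 3 Lc rfl)) κ' u'
  have hR3 : Push4.IsFF Q₃ := isFF_push₃ (l := M'p) (r := Tp) (w := Tp) (reslot Sum.inr Sum.inl (symVhSAt (toSite rt) 3 Lc rfl)) κ' u'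
  have hR4 : Push4.IsFF Q₄ := isFF_push₃ (l := M'p) (r := Bp) (w := Bp) (reslot Sum.inr Sum.inl (symVhSAt (toSite rt) 3 Lc rfl)) κ' u'
  have hZ : 0 ≤ Zl (3 + 1) (κ / (4 * ((3 : ℝ) + 1))) := Zl_nonneg (by positivity)
  have hRHS0 : 0 ≤ |cVH| * (2 * ((Lc : ℝ) ^ 3 * (((((3 + 1).factorial : ℕ) : ℝ) * (Lc : ℝ) ^ (3 + 1))⁻¹ * (((3 : ℝ) + 1) * (Real.exp (2 * ((3 : ℝ) + 1) * κ) ^ 2 *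
              (((2 * Lc : ℕ) : ℝ) ^ (3 + 1) * (((3 + 1 : ℕ) : ℝ) * ((((3 + 1).factorial : ℕ) : ℝ) * ((Lc : ℝ) ^ (3 + 1) * (ell (3 + 1) Lc : ℝ)))))))
            * ((2 * Tb * C₁ * cΔ + TΔ * C₁ ^ 2) * (4 * A + 4 * A ^ 2 + 4 * A * Lc + 8 * A ^ 2 * Lc))
            * Zl (3 + 1) (κ / (4 * ((3 : ℝ) + 1))))))
          * ((((n : ℝ) + 1)) * ((Lc : ℝ)⁻¹) ^ (n + 1))
          * Real.exp (-(κ / 12 / 2 / ((3 : ℝ) + 1)) * (l1 (x - u') + l1 (z - u'))) := by positivity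
  rcases a with α | μa
  · rcases b with β | νb
    · -- the cells: (B) on the fm pair and on the mf pair
      have hfm := abs_contact_border_fm_pair_le (d := 3) (Lc := Lc) (rr := rt) (n := n)
        (αg := A * C₁ * ((Lc : ℝ) ^ (5 * (n + 1)))⁻¹) (αΔ := A * cΔ * ((Lc : ℝ) ^ (5 * (n + 1)))⁻¹)
        (KB := C₁ * ((Lc : ℝ) ^ (5 * (n + 1)))⁻¹) (KΔ := cΔ * ((Lc : ℝ) ^ (5 * (n + 1)))⁻¹)
        (Tb := Tb * ((((Lc : ℝ) ^ n) ^ (2 * 3 + 1))⁻¹)) (TΔ := TΔ * ((((Lc : ℝ) ^ n) ^ (2 * 3 + 1))⁻¹))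
        (lam := lam) (lamp := lamq) (G := Gp) (Gp := Gq) (GΔ := GΔ) hLc1 hrt hκ (by positivity) (by positivity) (by positivity) (by positivity)
        (by positivity) (by positivity) hT hTs hB hTB hψ hG hTp hTps hBp hTBp hψq hGq hBΔ' hψΔ hGΔ' hMs hMps hMt' hMpt' hMΔt' κ' u' x z α β
      have hmf := abs_contact_border_mf_pair_le (d := 3) (Lc := Lc) (rr := rt) (n := n)
        (αg := A * C₁ * ((Lc : ℝ) ^ (5 * (n + 1)))⁻¹) (αΔ := A * cΔ * ((Lc : ℝ) ^ (5 * (n + 1)))⁻¹)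
        (KB := C₁ * ((Lc : ℝ) ^ (5 * (n + 1)))⁻¹) (KΔ := cΔ * ((Lc : ℝ) ^ (5 * (n + 1)))⁻¹)
        (Tb := Tb * ((((Lc : ℝ) ^ n) ^ (2 * 3 + 1))⁻¹)) (TΔ := TΔ * ((((Lc : ℝ) ^ n) ^ (2 * 3 + 1))⁻¹))
        (lam := lam) (lamp := lamq) (G := Gp) (Gp := Gq) (GΔ := GΔ) hLc1 hrt hκ (by positivity) (by positivity) (by positivity) (by positivity)
        (by positivity) (by positivity) hT hTs hB hTB hψ hG hTp hTps hBp hTBp hψq hGq hBΔ' hψΔ hGΔ' hM'b hM's hM'pb hM'ps hM't' hM'Δt' κ' u' x z α β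
      exact weighted_comb_pair_le_of_cells hcE hC₁ hcΔ hTb hTΔ hA hκ (by positivity) (by positivity) x z u' hfm hmf
    · -- `b = inr`: every push is ff-valued
      rw [hS1.2 x z (Sum.inl α) νb, hS2.2 x z (Sum.inl α) νb, hS3.2 x z (Sum.inl α) νb, hS4.2 x z (Sum.inl α) νb,
        hR1.2 x z (Sum.inl α) νb, hR2.2 x z (Sum.inl α) νb, hR3.2 x z (Sum.inl α) νb, hR4.2 x z (Sum.inl α) νb]
      simp only [sub_self, abs_zero, mul_zero]
      exact hRHS0
  · rw [hS1.1 x z μa b, hS2.1 x z μa b, hS3.1 x z μa b, hS4.1 x z μa b, hR1.1 x z μa b, hR2.1 x z μa b, hR3.1 x z μa b, hR4.1 x z μa b]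
    simp only [sub_self, abs_zero, mul_zero]
    exact hRHS0

end Lineage

end Summit.QuantumFields.BalabanUV.Beta.GAN24.CombBornBorderContactPairLineage

end
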